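import Literature.Analysis.PDE.ParabolicHolderNorm
import Literature.Analysis.FunctionSpaces.EquicontinuousSubsequence
import Mathlib.Analysis.Calculus.FDeriv.Partial
import Mathlib.Analysis.Calculus.UniformLimitsDeriv
import Mathlib.Analysis.InnerProductSpace.PiL2
import Mathlib.Topology.Instances.ENNReal.Lemmas
import HarnessLib

/-!
# Compactness of the unit ball of the parabolic `C^{2,α}` norm (White 2005, Thm. 8.1 backbone)

Topic `Literature/Analysis/PDE` (companion of `ParabolicHolderNorm.lean`, which defines parabolic
spacetime `Parabolic E`, the parabolic Hölder norms `holderNormOn`, the regularity guard `IsC21On`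
and the parabolic `C^{2,α}` norm `c2αNormOn α u W = ‖u‖_{0,α} + ‖Du‖_{0,α} + ‖D²u‖_{0,α} +
‖∂ₜu‖_{0,α}` of B. White, *A local regularity theorem for mean curvature flow*, Ann. of Math. 161
(2005), §2.5).  Everything here is PROVED (no named facts).

Main result: `Parabolic.exists_subseq_tendstoUniformlyOn_of_c2αNormOn_le_one` — if
`‖uᵢ‖_{2,α; B^{m,1}} ≤ 1` (`0 < α`, values in a finite-dimensional real normed space), then along a
subsequence `uᵢ → v` uniformly on the open parabolic unit ball `B^{m,1}`, together with `D uᵢ`,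
`D² uᵢ`, `∂ₜ uᵢ`, and `‖v‖_{2,α; B^{m,1}} ≤ 1`.  This is the analytic compactness statement on which
White's proof of the Arzelà–Ascoli theorem for `K_{2,α}` (ibid. Thm. 2.6 = Thm. 8.1: "by passing
to a subsequence … the `uᵢ` converge uniformly to `u : B^{m,1} → R^{N-m}` … `‖u‖_{2,α} ≤ 1`")
rests, and hence the blow-up arguments of ibid. §3 (Thms. 3.1, 3.2, 3.5) and §4; see the provefact
unit of `Literature/Geometry/Riemannian/WhiteLocalRegularityCylinderFlow.lean` and
`Literature/Geometry/Riemannian/FlowC2AlphaNorm.lean` (`K_{2,α}`).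

Also proved on the way: `Parabolic E` over a proper space is proper (closed parabolic balls are
compact), slices of the parabolic unit ball, pointwise / modulus consequences of a `C^{0,α}` bound,
lower semicontinuity of `holderNormOn` under pointwise convergence with convergent sup / Hölder
parts, slice derivatives under the guard `IsC21On`, derivatives of uniform limits on slices, and
the guard for functions with continuous partial derivatives (`hasStrictFDerivAt_uncurry_coprod`).

## References

* [White2005] B. White, *A local regularity theorem for mean curvature flow*, Ann. of Math. (2)
  161 (2005), 1487–1519, §2.5, §2.6, Thm. 8.1 and the Remark following it.
* Arzelà–Ascoli: `Literature/Analysis/FunctionSpaces/EquicontinuousSubsequence.lean` [folklore].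
-/
noncomputable section

open Metric Set Filter Topology Literature.Analysis.FunctionSpaces
open scoped NNReal ENNReal Topology

namespace Literature.Analysis.PDE

namespace Parabolic

/-! ### Compactness of parabolic balls -/

section Proper

variable {E : Type*} [PseudoMetricSpace E]

/-- Closed parabolic balls are products of closed balls (through `homeomorphProd`).
[cite: White2005, §2.1] -/
theorem preimage_closedBall_prod (X : Parabolic E) {r : ℝ} (hr : 0 ≤ r) :
    (homeomorphProd (E := E)) ⁻¹' (closedBall X.x r ×ˢ closedBall X.t (r ^ 2)) =
      closedBall X r := by
  ext Y
  simp only [mem_preimage, homeomorphProd_apply, mem_prod, mem_closedBall, dist_le_iff Y X hr]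

/-- Spacetime over a proper space is proper for the parabolic metric: closed parabolic balls are
compact. [cite: White2005, §2.1] -/
instance instProperSpace [ProperSpace E] : ProperSpace (Parabolic E) where
  isCompact_closedBall X r := by
    rcases lt_or_ge r 0 with hr | hr
    · rw [closedBall_eq_empty.2 hr]; exact isCompact_empty
    · rw [← preimage_closedBall_prod X hr, ← Homeomorph.image_symm]
      exact ((isCompact_closedBall _ _).prod (isCompact_closedBall _ _)).image
        (homeomorphProd (E := E)).symm.continuous

/-- Parabolic balls over a proper space are totally bounded. [cite: White2005, §2.1] -/
theorem totallyBounded_ball [ProperSpace E] (X : Parabolic E) (r : ℝ) : TotallyBounded (ball X r) :=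
  (isCompact_closedBall X r).totallyBounded.subset ball_subset_closedBall

end Proper

/-! ### Slices of the parabolic unit ball -/

section Slices

variable {E : Type*} [NormedAddCommGroup E]

/-- Membership in the parabolic unit ball: `‖x‖ < 1` and `|t| < 1` (`B^{m,1} = B^m × (-1, 1)`).
[cite: White2005, §2.5] -/
theorem mem_ball_zero_one_iff (X : Parabolic E) :
    X ∈ ball (0 : Parabolic E) 1 ↔ ‖X.x‖ < 1 ∧ |X.t| < 1 := by
  rw [mem_ball, dist_lt_iff _ _ one_pos]
  simp

/-- The spatial slice of the parabolic unit ball at an admissible time is the open unit ball.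
[cite: White2005, §2.5] -/
theorem spaceSlice_ball {t : ℝ} (ht : |t| < 1) :
    {x : E | (⟨x, t⟩ : Parabolic E) ∈ ball (0 : Parabolic E) 1} = ball (0 : E) 1 := by
  ext x
  rw [mem_setOf_eq, mem_ball_zero_one_iff]
  simp [ht]

/-- The time slice of the parabolic unit ball at an admissible point is `(-1, 1)`.
[cite: White2005, §2.5] -/
theorem timeSlice_ball {x : E} (hx : ‖x‖ < 1) :
    {t : ℝ | (⟨x, t⟩ : Parabolic E) ∈ ball (0 : Parabolic E) 1} = Ioo (-1 : ℝ) 1 := by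
  ext t
  rw [mem_setOf_eq, mem_ball_zero_one_iff, mem_Ioo, abs_lt]
  simp [hx, and_comm]

/-- Points of the parabolic unit ball from a spatial slice. [cite: White2005, §2.5] -/
theorem mk_mem_ball_of_mem_ball {t : ℝ} (ht : |t| < 1) {x : E} (hx : x ∈ ball (0 : E) 1) :
    (⟨x, t⟩ : Parabolic E) ∈ ball (0 : Parabolic E) 1 := by
  rw [mem_ball_zero_one_iff]; exact ⟨mem_ball_zero_iff.1 hx, ht⟩

/-- Points of the parabolic unit ball from a time slice. [cite: White2005, §2.5] -/
theorem mk_mem_ball_of_mem_Ioo {x : E} (hx : ‖x‖ < 1) {t : ℝ} (ht : t ∈ Ioo (-1 : ℝ) 1) :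
    (⟨x, t⟩ : Parabolic E) ∈ ball (0 : Parabolic E) 1 := by
  rw [mem_ball_zero_one_iff]; exact ⟨hx, abs_lt.2 ht⟩

/-- The parabolic unit ball, seen in `E × ℝ`, is open. [cite: White2005, §2.1] -/
theorem isOpen_setOf_mk_mem_ball :
    IsOpen {q : E × ℝ | (⟨q.1, q.2⟩ : Parabolic E) ∈ ball (0 : Parabolic E) 1} :=
  isOpen_ball.preimage (homeomorphProd (E := E)).symm.continuous

end Slices

/-! ### Consequences of a `C^{2,α}` bound -/

section Bounds

variable {G : Type*} [NormedAddCommGroup G]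

/-- A bound on the parabolic `C^{0,α}` norm bounds the function pointwise.
[cite: White2005, §8 p. 1515] -/
theorem norm_le_of_holderNormOn_le {E : Type*} [PseudoMetricSpace E] {α : ℝ≥0}
    {v : Parabolic E → G} {W : Set (Parabolic E)} {C : ℝ≥0} (h : holderNormOn α v W ≤ C)
    {X : Parabolic E} (hX : X ∈ W) : ‖v X‖ ≤ C := by
  have h1 : ‖v X‖ₑ ≤ (C : ℝ≥0∞) := (enorm_le_holderNormOn α v hX).trans h
  rw [← ofReal_norm] at h1
  have := ENNReal.ofReal_le_iff_le_toReal ENNReal.coe_ne_top |>.1 h1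
  simpa using this

/-- A bound on the parabolic `C^{0,α}` norm gives a Hölder modulus: `‖v X - v Y‖ ≤ C d(X,Y)^α`.
[cite: White2005, §8 p. 1515] -/
theorem norm_sub_le_of_holderNormOn_le {E : Type*} [MetricSpace E] {α : ℝ≥0}
    {v : Parabolic E → G} {W : Set (Parabolic E)} {C : ℝ≥0}
    (h : holderNormOn α v W ≤ C) {X Y : Parabolic E} (hX : X ∈ W) (hY : Y ∈ W) :
    ‖v X - v Y‖ ≤ C * dist X Y ^ (α : ℝ) := by
  have h1 := (edist_le_holderNormOn_mul α v hX hY).trans (mul_le_mul' h le_rfl)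
  rw [edist_dist, edist_dist, dist_eq_norm,
    ENNReal.ofReal_rpow_of_nonneg dist_nonneg (by positivity), ← ENNReal.ofReal_coe_nnreal,
    ← ENNReal.ofReal_mul (by positivity)] at h1
  exact (ENNReal.ofReal_le_ofReal_iff (by positivity)).1 h1

end Bounds

/-! ### Lower semicontinuity of the parabolic Hölder norm -/

section LSC

variable {E G : Type*} [MetricSpace E] [NormedAddCommGroup G]

/-- The Hölder seminorm bound `edist (f x) (f y) ≤ [f]_r · edist x y ^ r`, valid without a
membership hypothesis (in metric spaces). [folklore] -/
theorem edist_le_eHolderNorm_mul_rpow {Y : Type*} [MetricSpace Y] (r : ℝ≥0) (f : Y → G)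
    (x y : Y) : edist (f x) (f y) ≤ eHolderNorm r f * edist x y ^ (r : ℝ) := by
  by_cases h : MemHolder r f
  · rw [← h.coe_nnHolderNorm_eq_eHolderNorm]
    exact h.holderWith x y
  · have htop : eHolderNorm r f = ∞ := not_ne_iff.1 (eHolderNorm_ne_top.not.2 h)
    rw [htop]
    by_cases hxy : edist x y = 0
    · rw [edist_eq_zero.1 hxy, edist_self]; exact bot_le
    · rw [ENNReal.top_mul]
      · exact le_top
      · exact (ENNReal.rpow_pos (pos_iff_ne_zero.2 hxy) (edist_ne_top x y)).ne'

/-- **Lower semicontinuity of the parabolic `C^{0,α}` norm under pointwise convergence**: if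
`u i → v` pointwise on `W` and the sup parts / Hölder parts of `‖u i‖_{0,α;W}` converge to `s` /
`h` in `[0, ∞]`, then `‖v‖_{0,α;W} ≤ s + h`. [folklore] -/
theorem holderNormOn_le_of_tendsto {α : ℝ≥0} {W : Set (Parabolic E)} {u : ℕ → Parabolic E → G}
    {v : Parabolic E → G} (hv : ∀ X ∈ W, Tendsto (fun i => u i X) atTop (𝓝 (v X)))
    {s h : ℝ≥0∞} (hs : Tendsto (fun i => eSupNorm (W.restrict (u i))) atTop (𝓝 s))
    (hh : Tendsto (fun i => eHolderNorm α (W.restrict (u i))) atTop (𝓝 h)) :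
    holderNormOn α v W ≤ s + h := by
  rw [holderNormOn_eq]
  refine add_le_add ?_ ?_
  · refine iSup_le fun X => ?_
    have h1 : Tendsto (fun i => ‖u i X‖ₑ) atTop (𝓝 ‖v X‖ₑ) := (hv X X.2).enorm
    exact le_of_tendsto_of_tendsto' h1 hs fun i => enorm_le_eSupNorm (W.restrict (u i)) X
  · -- the limit is `h`-Hölder
    have hbound : ∀ X Y : W, edist (v X) (v Y) ≤ h * edist X Y ^ (α : ℝ) := by
      intro X Y
      have h1 : Tendsto (fun i => edist (u i X) (u i Y)) atTop (𝓝 (edist (v X) (v Y))) :=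
        (hv X X.2).edist (hv Y Y.2)
      have h2 : Tendsto (fun i => eHolderNorm α (W.restrict (u i)) * edist X Y ^ (α : ℝ)) atTop
          (𝓝 (h * edist X Y ^ (α : ℝ))) :=
        ENNReal.Tendsto.mul_const hh (Or.inr
          (ENNReal.rpow_ne_top_of_nonneg (by positivity) (edist_ne_top X Y)))
      exact le_of_tendsto_of_tendsto' h1 h2 fun i =>
        edist_le_eHolderNorm_mul_rpow α (W.restrict (u i)) X Y
    rcases eq_or_ne h ∞ with htop | hne
    · rw [htop]; exact le_top
    · lift h to ℝ≥0 using hne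
      exact HolderWith.eHolderNorm_le fun X Y => hbound X Y

/-- `holderNormOn` only depends on the values on the set. [folklore] -/
theorem holderNormOn_congr {E : Type*} [PseudoMetricSpace E] {α : ℝ≥0} {v v' : Parabolic E → G}
    {W : Set (Parabolic E)} (h : EqOn v v' W) : holderNormOn α v W = holderNormOn α v' W := by
  have : W.restrict v = W.restrict v' := funext fun X => h X.2
  rw [holderNormOn, holderNormOn, this]

end LSC


/-! ### Slices of differentiable functions on spacetime -/

section SliceDeriv

variable {E F : Type*} [NormedAddCommGroup E] [NormedSpace ℝ E] [NormedAddCommGroup F]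
  [NormedSpace ℝ F]

/-- Under the regularity guard, spatial slices are differentiable with derivative `D u`.
[cite: White2005, §8 p. 1515] -/
theorem IsC21On.hasFDerivAt_space {u : Parabolic E → F} {W : Set (Parabolic E)} (h : IsC21On u W)
    {x : E} {t : ℝ} (hX : (⟨x, t⟩ : Parabolic E) ∈ W) :
    HasFDerivAt (fun x' => u ⟨x', t⟩) (spaceDeriv u ⟨x, t⟩) x := by
  have hd : DifferentiableAt ℝ ((fun p : E × ℝ => u ⟨p.1, p.2⟩) ∘ fun x' : E => (x', t)) x :=
    (h.differentiableAt ⟨x, t⟩ hX).comp x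
      ((differentiableAt_id (𝕜 := ℝ)).prodMk (differentiableAt_const t))
  exact hd.hasFDerivAt

/-- Under the regularity guard, spatial slices of `D u` are differentiable with derivative `D² u`.
[cite: White2005, §8 p. 1515] -/
theorem IsC21On.hasFDerivAt_spaceDeriv {u : Parabolic E → F} {W : Set (Parabolic E)}
    (h : IsC21On u W) {x : E} {t : ℝ} (hX : (⟨x, t⟩ : Parabolic E) ∈ W) :
    HasFDerivAt (fun x' => spaceDeriv u ⟨x', t⟩) (spaceDeriv (spaceDeriv u) ⟨x, t⟩) x :=
  (h.differentiableAt_spaceDeriv ⟨x, t⟩ hX).hasFDerivAt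

/-- Under the regularity guard, time slices are differentiable with derivative `∂ₜ u`.
[cite: White2005, §8 p. 1515] -/
theorem IsC21On.hasDerivAt_time {u : Parabolic E → F} {W : Set (Parabolic E)} (h : IsC21On u W)
    {x : E} {t : ℝ} (hX : (⟨x, t⟩ : Parabolic E) ∈ W) :
    HasDerivAt (fun t' => u ⟨x, t'⟩) (timeDeriv u ⟨x, t⟩) t := by
  have hd : DifferentiableAt ℝ ((fun p : E × ℝ => u ⟨p.1, p.2⟩) ∘ fun t' : ℝ => (x, t')) t :=
    (h.differentiableAt ⟨x, t⟩ hX).comp t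
      ((differentiableAt_const x).prodMk (differentiableAt_id (𝕜 := ℝ)))
  exact hd.hasDerivAt

/-- **Derivatives of uniform limits on the parabolic unit ball, spatial slices**: if
`fᵢ → v` and `gᵢ → V` uniformly on `B^{m,1}` and `gᵢ(·, t)` is the derivative of `fᵢ(·, t)` on
every spatial slice, then `V(·, t)` is the derivative of `v(·, t)`. [folklore] -/
theorem hasFDerivAt_space_of_tendstoUniformlyOn {G : Type*} [NormedAddCommGroup G]
    [NormedSpace ℝ G] {f : ℕ → Parabolic E → G} {g : ℕ → Parabolic E → (E →L[ℝ] G)}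
    {v : Parabolic E → G} {V : Parabolic E → (E →L[ℝ] G)}
    (hf : ∀ i (x : E) (t : ℝ), (⟨x, t⟩ : Parabolic E) ∈ ball (0 : Parabolic E) 1 →
      HasFDerivAt (fun x' => f i ⟨x', t⟩) (g i ⟨x, t⟩) x)
    (hfv : TendstoUniformlyOn f v atTop (ball 0 1)) (hgV : TendstoUniformlyOn g V atTop (ball 0 1))
    {x : E} {t : ℝ} (hX : (⟨x, t⟩ : Parabolic E) ∈ ball (0 : Parabolic E) 1) :
    HasFDerivAt (fun x' => v ⟨x', t⟩) (V ⟨x, t⟩) x := by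
  have ht : |t| < 1 := ((mem_ball_zero_one_iff _).1 hX).2
  have hx : x ∈ ball (0 : E) 1 := by simpa using ((mem_ball_zero_one_iff _).1 hX).1
  have hpre : (fun x' : E => (⟨x', t⟩ : Parabolic E)) ⁻¹' ball (0 : Parabolic E) 1 = ball 0 1 :=
    spaceSlice_ball ht
  have hc := hgV.comp fun x' : E => (⟨x', t⟩ : Parabolic E)
  rw [hpre] at hc
  exact hasFDerivAt_of_tendstoUniformlyOn (l := atTop) isOpen_ball (f := fun i x' => f i ⟨x', t⟩)
    (g := fun x' => v ⟨x', t⟩) (f' := fun i x' => g i ⟨x', t⟩) (g' := fun x' => V ⟨x', t⟩) hc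
    (fun i x' hx' => hf i x' t (mk_mem_ball_of_mem_ball ht hx'))
    (fun x' hx' => hfv.tendsto_at (mk_mem_ball_of_mem_ball ht hx')) hx

omit [NormedSpace ℝ E] in
/-- **Derivatives of uniform limits on the parabolic unit ball, time slices.** [folklore] -/
theorem hasDerivAt_time_of_tendstoUniformlyOn {G : Type*} [NormedAddCommGroup G] [NormedSpace ℝ G]
    {f : ℕ → Parabolic E → G} {g : ℕ → Parabolic E → G} {v : Parabolic E → G} {Z : Parabolic E → G}
    (hf : ∀ i (x : E) (t : ℝ), (⟨x, t⟩ : Parabolic E) ∈ ball (0 : Parabolic E) 1 →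
      HasDerivAt (fun t' => f i ⟨x, t'⟩) (g i ⟨x, t⟩) t)
    (hfv : TendstoUniformlyOn f v atTop (ball 0 1)) (hgZ : TendstoUniformlyOn g Z atTop (ball 0 1))
    {x : E} {t : ℝ} (hX : (⟨x, t⟩ : Parabolic E) ∈ ball (0 : Parabolic E) 1) :
    HasDerivAt (fun t' => v ⟨x, t'⟩) (Z ⟨x, t⟩) t := by
  have hx : ‖x‖ < 1 := ((mem_ball_zero_one_iff _).1 hX).1
  have ht : t ∈ Ioo (-1 : ℝ) 1 := by
    have := ((mem_ball_zero_one_iff _).1 hX).2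
    rw [abs_lt] at this; exact ⟨this.1, this.2⟩
  have hpre : (fun t' : ℝ => (⟨x, t'⟩ : Parabolic E)) ⁻¹' ball (0 : Parabolic E) 1 = Ioo (-1) 1 :=
    timeSlice_ball hx
  have hc := hgZ.comp fun t' : ℝ => (⟨x, t'⟩ : Parabolic E)
  rw [hpre] at hc
  exact hasDerivAt_of_tendstoUniformlyOn (l := atTop) isOpen_Ioo (f := fun i t' => f i ⟨x, t'⟩)
    (g := fun t' => v ⟨x, t'⟩) (f' := fun i t' => g i ⟨x, t'⟩) (g' := fun t' => Z ⟨x, t'⟩) hc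
    (Eventually.of_forall fun i t' ht' => hf i x t' (mk_mem_ball_of_mem_Ioo hx ht'))
    (fun t' ht' => hfv.tendsto_at (mk_mem_ball_of_mem_Ioo hx ht')) ht

/-- If `V` is the spatial derivative of `v` on `B^{m,1}` and `V(·, t)` has derivative `V2`, then
`D (D v) = V2` on `B^{m,1}` (the spatial slice is open). [folklore] -/
theorem hasFDerivAt_spaceDeriv_of_partial {v : Parabolic E → F} {V : Parabolic E → (E →L[ℝ] F)}
    {V2 : Parabolic E → (E →L[ℝ] E →L[ℝ] F)}
    (hDv : ∀ (x : E) (t : ℝ), (⟨x, t⟩ : Parabolic E) ∈ ball (0 : Parabolic E) 1 →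
      HasFDerivAt (fun x' => v ⟨x', t⟩) (V ⟨x, t⟩) x)
    (hDV : ∀ (x : E) (t : ℝ), (⟨x, t⟩ : Parabolic E) ∈ ball (0 : Parabolic E) 1 →
      HasFDerivAt (fun x' => V ⟨x', t⟩) (V2 ⟨x, t⟩) x)
    {x : E} {t : ℝ} (hX : (⟨x, t⟩ : Parabolic E) ∈ ball (0 : Parabolic E) 1) :
    HasFDerivAt (fun x' => spaceDeriv v ⟨x', t⟩) (V2 ⟨x, t⟩) x := by
  have ht : |t| < 1 := ((mem_ball_zero_one_iff _).1 hX).2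
  have hx : x ∈ ball (0 : E) 1 := by simpa using ((mem_ball_zero_one_iff _).1 hX).1
  refine (hDV x t hX).congr_of_eventuallyEq ?_
  filter_upwards [isOpen_ball.mem_nhds hx] with x' hx'
  exact (hDv x' t (mk_mem_ball_of_mem_ball ht hx')).fderiv

/-- **The regularity guard for a function with continuous partial derivatives on the parabolic
unit ball** (Mathlib's `hasStrictFDerivAt_uncurry_coprod`): if `v(·, t)` has derivative `V` and
`v(x, ·)` has derivative `Z` throughout `B^{m,1}`, with `V`, `Z` continuous on `B^{m,1}`, and
`V(·, t)` is differentiable in space, then `IsC21On v B^{m,1}`. [folklore] -/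
theorem isC21On_ball_of_partial {v : Parabolic E → F} {V : Parabolic E → (E →L[ℝ] F)}
    {V2 : Parabolic E → (E →L[ℝ] E →L[ℝ] F)} {Z : Parabolic E → F}
    (hDv : ∀ (x : E) (t : ℝ), (⟨x, t⟩ : Parabolic E) ∈ ball (0 : Parabolic E) 1 →
      HasFDerivAt (fun x' => v ⟨x', t⟩) (V ⟨x, t⟩) x)
    (hDV : ∀ (x : E) (t : ℝ), (⟨x, t⟩ : Parabolic E) ∈ ball (0 : Parabolic E) 1 →
      HasFDerivAt (fun x' => V ⟨x', t⟩) (V2 ⟨x, t⟩) x)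
    (hDt : ∀ (x : E) (t : ℝ), (⟨x, t⟩ : Parabolic E) ∈ ball (0 : Parabolic E) 1 →
      HasDerivAt (fun t' => v ⟨x, t'⟩) (Z ⟨x, t⟩) t)
    (hVc : ContinuousOn V (ball 0 1)) (hZc : ContinuousOn Z (ball 0 1)) :
    IsC21On v (ball (0 : Parabolic E) 1) := by
  refine ⟨fun X hX => ?_,
    fun X hX => (hasFDerivAt_spaceDeriv_of_partial hDv hDV hX).differentiableAt⟩
  have hopen : {q : E × ℝ | (⟨q.1, q.2⟩ : Parabolic E) ∈ ball (0 : Parabolic E) 1} ∈ 𝓝 (X.x, X.t) :=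
    isOpen_setOf_mk_mem_ball.mem_nhds (by simpa using hX)
  have hsymm : ContinuousAt (fun q : E × ℝ => (⟨q.1, q.2⟩ : Parabolic E)) (X.x, X.t) :=
    (homeomorphProd (E := E)).symm.continuous.continuousAt
  have h1 : ContinuousAt V X := hVc.continuousAt (isOpen_ball.mem_nhds hX)
  have h2 : ContinuousAt Z X := hZc.continuousAt (isOpen_ball.mem_nhds hX)
  have h3 : Continuous fun z : F => (1 : ℝ →L[ℝ] ℝ).smulRight z :=
    (ContinuousLinearMap.smulRightL ℝ ℝ F (1 : ℝ →L[ℝ] ℝ)).continuous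
  have hst := hasStrictFDerivAt_uncurry_coprod (𝕜 := ℝ) (u := (X.x, X.t))
    (f := fun x t => v ⟨x, t⟩) (f₁ := fun x t => V ⟨x, t⟩)
    (f₂ := fun x t => (1 : ℝ →L[ℝ] ℝ).smulRight (Z ⟨x, t⟩))
    (by filter_upwards [hopen] with q hq using hDv q.1 q.2 hq)
    (by filter_upwards [hopen] with q hq using (hDt q.1 q.2 hq).hasFDerivAt)
    (ContinuousAt.comp (g := V) (by simpa using h1) hsymm)
    (h3.continuousAt.comp (ContinuousAt.comp (g := Z) (by simpa using h2) hsymm))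
  exact hst.hasFDerivAt.differentiableAt

end SliceDeriv

/-! ### Compactness of the unit ball of the parabolic `C^{2,α}` norm (White 2005, Thm. 8.1) -/

section Compactness

variable {m : ℕ} {F : Type*} [NormedAddCommGroup F] [NormedSpace ℝ F]

/-- A bound `‖w‖_{0,α;W} ≤ 1` makes `w` `α`-Hölder with constant `1` on `W`.
[cite: White2005, §8 p. 1515] -/
theorem holderOnWith_of_holderNormOn_le_one {G : Type*} [NormedAddCommGroup G] {α : ℝ≥0}
    {w : Parabolic (EuclideanSpace ℝ (Fin m)) → G} {W : Set (Parabolic (EuclideanSpace ℝ (Fin m)))}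
    (hw : holderNormOn α w W ≤ 1) : HolderOnWith 1 α w W := fun _ hX _ hY =>
  (edist_le_holderNormOn_mul α w hX hY).trans (mul_le_mul' (by simpa using hw) le_rfl)

/-- A bound `‖w‖_{0,α;W} ≤ 1` gives the uniform modulus `dist (w X) (w Y) ≤ ε` once
`dist X Y < ε ^ (1/α)`. [cite: White2005, §8 p. 1515] -/
theorem dist_le_of_holderNormOn_le_one {G : Type*} [NormedAddCommGroup G] {α : ℝ≥0} (hα : 0 < α)
    {w : Parabolic (EuclideanSpace ℝ (Fin m)) → G} {W : Set (Parabolic (EuclideanSpace ℝ (Fin m)))}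
    (hw : holderNormOn α w W ≤ 1) {ε : ℝ} (hε : 0 < ε) {X Y : Parabolic (EuclideanSpace ℝ (Fin m))}
    (hX : X ∈ W) (hY : Y ∈ W) (hXY : dist X Y < ε ^ (1 / (α : ℝ))) : dist (w X) (w Y) ≤ ε := by
  have hα' : (α : ℝ) ≠ 0 := (NNReal.coe_pos.2 hα).ne'
  have hd : dist X Y ^ (α : ℝ) ≤ ε := by
    calc dist X Y ^ (α : ℝ) ≤ (ε ^ (1 / (α : ℝ))) ^ (α : ℝ) :=
          Real.rpow_le_rpow dist_nonneg hXY.le α.2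
      _ = ε := by rw [← Real.rpow_mul hε.le, one_div_mul_cancel hα', Real.rpow_one]
  rw [dist_eq_norm]
  calc ‖w X - w Y‖ ≤ (1 : ℝ≥0) * dist X Y ^ (α : ℝ) := norm_sub_le_of_holderNormOn_le hw hX hY
    _ ≤ ε := by rw [NNReal.coe_one, one_mul]; exact hd

/-- The eight sup / Hölder parts of `‖u‖_{2,α;W}` as a vector in `[0, ∞]⁸`.
[cite: White2005, §2.5] -/
def normParts (α : ℝ≥0) (u : Parabolic (EuclideanSpace ℝ (Fin m)) → F)
    (W : Set (Parabolic (EuclideanSpace ℝ (Fin m)))) : Fin 8 → ℝ≥0∞ :=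
  ![eSupNorm (W.restrict u), eHolderNorm α (W.restrict u),
    eSupNorm (W.restrict (spaceDeriv u)), eHolderNorm α (W.restrict (spaceDeriv u)),
    eSupNorm (W.restrict (spaceDeriv (spaceDeriv u))),
    eHolderNorm α (W.restrict (spaceDeriv (spaceDeriv u))),
    eSupNorm (W.restrict (timeDeriv u)), eHolderNorm α (W.restrict (timeDeriv u))]

/-- Under the guard, `‖u‖_{2,α;W}` is the sum of its eight parts. [cite: White2005, §2.5] -/
theorem c2αNormOn_eq_sum_normParts {α : ℝ≥0} {u : Parabolic (EuclideanSpace ℝ (Fin m)) → F}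
    {W : Set (Parabolic (EuclideanSpace ℝ (Fin m)))} (h : IsC21On u W) :
    c2αNormOn α u W = ∑ k, normParts α u W k := by
  rw [c2αNormOn_eq h, holderNormOn_eq, holderNormOn_eq, holderNormOn_eq, holderNormOn_eq]
  simp [normParts, Fin.sum_univ_succ, add_assoc]

/-- **Step 1 of the compactness theorem**: along a subsequence the eight parts of
`‖uᵢ‖_{2,α;W}` converge in the compact space `[0, ∞]⁸`, to a limit of total mass `≤ 1` when
`‖uᵢ‖_{2,α;W} ≤ 1`. [cite: White2005, Thm. 8.1] -/
theorem exists_subseq_tendsto_normParts {α : ℝ≥0}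
    (u : ℕ → Parabolic (EuclideanSpace ℝ (Fin m)) → F)
    {W : Set (Parabolic (EuclideanSpace ℝ (Fin m)))} (hu : ∀ i, c2αNormOn α (u i) W ≤ 1) :
    ∃ ψ : ℕ → ℕ, StrictMono ψ ∧ ∃ L : Fin 8 → ℝ≥0∞, ∑ k, L k ≤ 1 ∧
      ∀ k, Tendsto (fun i => normParts α (u (ψ i)) W k) atTop (𝓝 (L k)) := by
  obtain ⟨L, -, ψ, hψ, hL⟩ := (isCompact_univ (X := Fin 8 → ℝ≥0∞)).tendsto_subseq
    (x := fun i => normParts α (u i) W) fun i => mem_univ _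
  have hLk : ∀ k : Fin 8, Tendsto (fun i => normParts α (u (ψ i)) W k) atTop (𝓝 (L k)) := fun k =>
    ((continuous_apply k).tendsto L).comp hL
  refine ⟨ψ, hψ, L, ?_, hLk⟩
  have hsum : ∀ i, ∑ k, normParts α (u i) W k ≤ 1 := fun i => by
    rw [← c2αNormOn_eq_sum_normParts
      (isC21On_of_c2αNormOn_ne_top (ne_top_of_le_ne_top ENNReal.one_ne_top (hu i)))]
    exact hu i
  exact le_of_tendsto' (tendsto_finsetSum _ fun k _ => hLk k) fun i => hsum (ψ i)

variable [FiniteDimensional ℝ F]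

/-- **Step 2 of the compactness theorem (Arzelà–Ascoli for the `2`-jets)**: if the four parts
`uᵢ, D uᵢ, D² uᵢ, ∂ₜ uᵢ` have parabolic `C^{0,α}` norm `≤ 1` on `B^{m,1}` (`0 < α`), a subsequence
of the jets converges uniformly on `B^{m,1}`. [cite: White2005, Thm. 8.1] -/
theorem exists_subseq_jets_tendstoUniformlyOn {α : ℝ≥0} (hα : 0 < α)
    (u : ℕ → Parabolic (EuclideanSpace ℝ (Fin m)) → F)
    (h0 : ∀ i, holderNormOn α (u i) (ball 0 1) ≤ 1)
    (h1 : ∀ i, holderNormOn α (spaceDeriv (u i)) (ball 0 1) ≤ 1)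
    (h2 : ∀ i, holderNormOn α (spaceDeriv (spaceDeriv (u i))) (ball 0 1) ≤ 1)
    (h3 : ∀ i, holderNormOn α (timeDeriv (u i)) (ball 0 1) ≤ 1) :
    ∃ φ : ℕ → ℕ, StrictMono φ ∧ ∃ (v : Parabolic (EuclideanSpace ℝ (Fin m)) → F)
      (V : Parabolic (EuclideanSpace ℝ (Fin m)) → (EuclideanSpace ℝ (Fin m) →L[ℝ] F))
      (V2 : Parabolic (EuclideanSpace ℝ (Fin m)) →
        (EuclideanSpace ℝ (Fin m) →L[ℝ] EuclideanSpace ℝ (Fin m) →L[ℝ] F))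
      (Z : Parabolic (EuclideanSpace ℝ (Fin m)) → F),
      TendstoUniformlyOn (fun i => u (φ i)) v atTop (ball 0 1) ∧
      TendstoUniformlyOn (fun i => spaceDeriv (u (φ i))) V atTop (ball 0 1) ∧
      TendstoUniformlyOn (fun i => spaceDeriv (spaceDeriv (u (φ i)))) V2 atTop (ball 0 1) ∧
      TendstoUniformlyOn (fun i => timeDeriv (u (φ i))) Z atTop (ball 0 1) := by
  let Wmap : ℕ → Parabolic (EuclideanSpace ℝ (Fin m)) →
      F × (EuclideanSpace ℝ (Fin m) →L[ℝ] F) ×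
        (EuclideanSpace ℝ (Fin m) →L[ℝ] EuclideanSpace ℝ (Fin m) →L[ℝ] F) × F := fun i X =>
    (u i X, spaceDeriv (u i) X, spaceDeriv (spaceDeriv (u i)) X, timeDeriv (u i) X)
  -- the closed unit ball of the (finite-dimensional) jet space is compact
  have hK := @isCompact_closedBall _ _ (FiniteDimensional.proper_real
    (F × (EuclideanSpace ℝ (Fin m) →L[ℝ] F) ×
      (EuclideanSpace ℝ (Fin m) →L[ℝ] EuclideanSpace ℝ (Fin m) →L[ℝ] F) × F)) 0 1
  have hval : ∀ i, ∀ X ∈ ball (0 : Parabolic (EuclideanSpace ℝ (Fin m))) 1,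
      Wmap i X ∈ closedBall 0 1 := by
    intro i X hX
    have hn : ‖Wmap i X‖ ≤ 1 := by
      change max ‖u i X‖ (max ‖spaceDeriv (u i) X‖
        (max ‖spaceDeriv (spaceDeriv (u i)) X‖ ‖timeDeriv (u i) X‖)) ≤ 1
      exact max_le (norm_le_of_holderNormOn_le (h0 _) hX)
        (max_le (norm_le_of_holderNormOn_le (h1 _) hX)
          (max_le (norm_le_of_holderNormOn_le (h2 _) hX) (norm_le_of_holderNormOn_le (h3 _) hX)))
    exact mem_closedBall.2 ((_root_.dist_zero_right (Wmap i X)).trans_le hn)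
  have hequi : ∀ ε > (0 : ℝ), ∃ δ > (0 : ℝ), ∀ i,
      ∀ X ∈ ball (0 : Parabolic (EuclideanSpace ℝ (Fin m))) 1,
      ∀ Y ∈ ball (0 : Parabolic (EuclideanSpace ℝ (Fin m))) 1,
      dist X Y < δ → dist (Wmap i X) (Wmap i Y) ≤ ε := by
    intro ε hε
    refine ⟨ε ^ (1 / (α : ℝ)), by positivity, fun i X hX Y hY hXY => ?_⟩
    change max (dist (u i X) (u i Y)) (max (dist (spaceDeriv (u i) X) (spaceDeriv (u i) Y))
      (max (dist (spaceDeriv (spaceDeriv (u i)) X) (spaceDeriv (spaceDeriv (u i)) Y))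
        (dist (timeDeriv (u i) X) (timeDeriv (u i) Y)))) ≤ ε
    exact max_le (dist_le_of_holderNormOn_le_one hα (h0 _) hε hX hY hXY)
      (max_le (dist_le_of_holderNormOn_le_one hα (h1 _) hε hX hY hXY)
        (max_le (dist_le_of_holderNormOn_le_one hα (h2 _) hε hX hY hXY)
          (dist_le_of_holderNormOn_le_one hα (h3 _) hε hX hY hXY)))
  obtain ⟨φ, hφ, Wlim, hW⟩ :=
    exists_subseq_tendstoUniformlyOn_of_equicontinuous (totallyBounded_ball 0 1) hK Wmap hval hequi
  refine ⟨φ, hφ, fun X => (Wlim X).1, fun X => (Wlim X).2.1, fun X => (Wlim X).2.2.1,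
    fun X => (Wlim X).2.2.2, ?_, ?_, ?_, ?_⟩
  · exact uniformContinuous_fst.comp_tendstoUniformlyOn hW
  · exact (uniformContinuous_fst.comp uniformContinuous_snd).comp_tendstoUniformlyOn hW
  · exact (uniformContinuous_fst.comp (uniformContinuous_snd.comp uniformContinuous_snd))
      |>.comp_tendstoUniformlyOn hW
  · exact (uniformContinuous_snd.comp (uniformContinuous_snd.comp uniformContinuous_snd))
      |>.comp_tendstoUniformlyOn hW

omit [FiniteDimensional ℝ F] in
/-- **Step 3 of the compactness theorem (identification of the limit jet)**: if the jets of
`uᵢ` (each satisfying the regularity guard, with `‖D uᵢ‖_{0,α}, ‖∂ₜ uᵢ‖_{0,α} ≤ 1`) converge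
uniformly on `B^{m,1}` to `(v, V, V2, Z)`, then `v` satisfies the guard and `D v = V`,
`D² v = V2`, `∂ₜ v = Z` on `B^{m,1}`. [cite: White2005, Thm. 8.1] -/
theorem isC21On_of_jets_tendstoUniformlyOn {α : ℝ≥0} (hα : 0 < α)
    {u : ℕ → Parabolic (EuclideanSpace ℝ (Fin m)) → F}
    (hC : ∀ i, IsC21On (u i) (ball 0 1))
    (h1 : ∀ i, holderNormOn α (spaceDeriv (u i)) (ball 0 1) ≤ 1)
    (h3 : ∀ i, holderNormOn α (timeDeriv (u i)) (ball 0 1) ≤ 1)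
    {v : Parabolic (EuclideanSpace ℝ (Fin m)) → F}
    {V : Parabolic (EuclideanSpace ℝ (Fin m)) → (EuclideanSpace ℝ (Fin m) →L[ℝ] F)}
    {V2 : Parabolic (EuclideanSpace ℝ (Fin m)) →
      (EuclideanSpace ℝ (Fin m) →L[ℝ] EuclideanSpace ℝ (Fin m) →L[ℝ] F)}
    {Z : Parabolic (EuclideanSpace ℝ (Fin m)) → F}
    (hcu : TendstoUniformlyOn u v atTop (ball 0 1))
    (hcV : TendstoUniformlyOn (fun i => spaceDeriv (u i)) V atTop (ball 0 1))
    (hcV2 : TendstoUniformlyOn (fun i => spaceDeriv (spaceDeriv (u i))) V2 atTop (ball 0 1))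
    (hcZ : TendstoUniformlyOn (fun i => timeDeriv (u i)) Z atTop (ball 0 1)) :
    IsC21On v (ball 0 1) ∧ (∀ X ∈ ball (0 : Parabolic (EuclideanSpace ℝ (Fin m))) 1,
      spaceDeriv v X = V X) ∧
      (∀ X ∈ ball (0 : Parabolic (EuclideanSpace ℝ (Fin m))) 1,
        spaceDeriv (spaceDeriv v) X = V2 X) ∧
      (∀ X ∈ ball (0 : Parabolic (EuclideanSpace ℝ (Fin m))) 1, timeDeriv v X = Z X) := by
  -- continuity of the limits of the derivatives on `B`
  have hVc : ContinuousOn V (ball 0 1) := hcV.continuousOn (Eventually.of_forall fun i =>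
    (holderOnWith_of_holderNormOn_le_one (h1 i)).continuousOn hα).frequently
  have hZc : ContinuousOn Z (ball 0 1) := hcZ.continuousOn (Eventually.of_forall fun i =>
    (holderOnWith_of_holderNormOn_le_one (h3 i)).continuousOn hα).frequently
  -- the limits of the derivatives are the derivatives of the limit
  have hDv : ∀ x t, (⟨x, t⟩ : Parabolic _) ∈ ball (0 : Parabolic (EuclideanSpace ℝ (Fin m))) 1 →
      HasFDerivAt (fun x' => v ⟨x', t⟩) (V ⟨x, t⟩) x :=
    fun x t hX => hasFDerivAt_space_of_tendstoUniformlyOn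
      (fun i x t hX => (hC i).hasFDerivAt_space hX) hcu hcV hX
  have hDV : ∀ x t, (⟨x, t⟩ : Parabolic _) ∈ ball (0 : Parabolic (EuclideanSpace ℝ (Fin m))) 1 →
      HasFDerivAt (fun x' => V ⟨x', t⟩) (V2 ⟨x, t⟩) x :=
    fun x t hX => hasFDerivAt_space_of_tendstoUniformlyOn
      (fun i x t hX => (hC i).hasFDerivAt_spaceDeriv hX) hcV hcV2 hX
  have hDt : ∀ x t, (⟨x, t⟩ : Parabolic _) ∈ ball (0 : Parabolic (EuclideanSpace ℝ (Fin m))) 1 →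
      HasDerivAt (fun t' => v ⟨x, t'⟩) (Z ⟨x, t⟩) t :=
    fun x t hX => hasDerivAt_time_of_tendstoUniformlyOn
      (fun i x t hX => (hC i).hasDerivAt_time hX) hcu hcZ hX
  exact ⟨isC21On_ball_of_partial hDv hDV hDt hVc hZc, fun X hX => (hDv X.x X.t hX).fderiv,
    fun X hX => (hasFDerivAt_spaceDeriv_of_partial hDv hDV hX).fderiv,
    fun X hX => (hDt X.x X.t hX).deriv⟩

/-- **Compactness of the unit parabolic `C^{2,α}` ball** (the analytic backbone of White 2005,
Thm. 8.1 / §2.6, "by passing to a subsequence … the `uᵢ` converge uniformly to a function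
`u : B^{m,1} → R^{N-m}` with `‖u‖_{2,α} ≤ 1`"; cf. the Remark after Thm. 8.1: all that is used is
that `{u : ‖u‖_{2,α} ≤ 1}` is compact in `C⁰`).  If `‖uᵢ‖_{2,α; B^{m,1}} ≤ 1` for all `i` (`0 < α`),
then a subsequence converges UNIFORMLY on the open parabolic unit ball `B^{m,1}` to a function `v`
with `‖v‖_{2,α; B^{m,1}} ≤ 1`; moreover `D uᵢ → D v`, `D² uᵢ → D² v`, `∂ₜ uᵢ → ∂ₜ v` uniformly
along the subsequence.  Proof: the jets `X ↦ (uᵢ X, Duᵢ X, D²uᵢ X, ∂ₜuᵢ X)` are uniformly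
`α`-Hölder with values in a compact set, so the sequential Arzelà–Ascoli theorem on the totally
bounded ball applies; the limits of the derivatives are the derivatives of the limit (uniform
convergence of derivatives on spatial / temporal slices), the limit satisfies the regularity
guard by Mathlib's `hasStrictFDerivAt_uncurry_coprod` (continuous partial derivatives), and the
norm bound passes to the limit by lower semicontinuity (the eight sup/Hölder parts are first made
convergent in `[0, ∞]⁸`). [cite: White2005, Thm. 8.1] -/
theorem exists_subseq_tendstoUniformlyOn_of_c2αNormOn_le_one {α : ℝ≥0} (hα : 0 < α)
    (u : ℕ → Parabolic (EuclideanSpace ℝ (Fin m)) → F)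
    (hu : ∀ i, c2αNormOn α (u i) (ball 0 1) ≤ 1) :
    ∃ φ : ℕ → ℕ, StrictMono φ ∧ ∃ v : Parabolic (EuclideanSpace ℝ (Fin m)) → F,
      c2αNormOn α v (ball 0 1) ≤ 1 ∧
      TendstoUniformlyOn (fun i => u (φ i)) v atTop (ball 0 1) ∧
      TendstoUniformlyOn (fun i => spaceDeriv (u (φ i))) (spaceDeriv v) atTop (ball 0 1) ∧
      TendstoUniformlyOn (fun i => spaceDeriv (spaceDeriv (u (φ i))))
        (spaceDeriv (spaceDeriv v)) atTop (ball 0 1) ∧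
      TendstoUniformlyOn (fun i => timeDeriv (u (φ i))) (timeDeriv v) atTop (ball 0 1) := by
  -- the guard and the component bounds
  have hC : ∀ i, IsC21On (u i) (ball 0 1) := fun i =>
    isC21On_of_c2αNormOn_ne_top (ne_top_of_le_ne_top ENNReal.one_ne_top (hu i))
  have h0 : ∀ i, holderNormOn α (u i) (ball 0 1) ≤ 1 := fun i =>
    (holderNormOn_le_c2αNormOn α (u i) _).trans (hu i)
  have h1 : ∀ i, holderNormOn α (spaceDeriv (u i)) (ball 0 1) ≤ 1 := fun i =>
    (holderNormOn_spaceDeriv_le_c2αNormOn α (u i) _).trans (hu i)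
  have h2 : ∀ i, holderNormOn α (spaceDeriv (spaceDeriv (u i))) (ball 0 1) ≤ 1 := fun i =>
    (holderNormOn_spaceDeriv_spaceDeriv_le_c2αNormOn α (u i) _).trans (hu i)
  have h3 : ∀ i, holderNormOn α (timeDeriv (u i)) (ball 0 1) ≤ 1 := fun i =>
    (holderNormOn_timeDeriv_le_c2αNormOn α (u i) _).trans (hu i)
  -- Step 1: the parts of the norms converge along `ψ`
  obtain ⟨ψ, hψ, L, hLsum, hLk⟩ := exists_subseq_tendsto_normParts u hu
  -- Step 2: Arzelà–Ascoli for the jets along a further subsequence `φ`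
  obtain ⟨φ, hφ, v, V, V2, Z, hcu, hcV, hcV2, hcZ⟩ := exists_subseq_jets_tendstoUniformlyOn hα
    (fun i => u (ψ i)) (fun i => h0 _) (fun i => h1 _) (fun i => h2 _) (fun i => h3 _)
  -- Step 3: identification of the limit jet
  obtain ⟨hguard, hspace, hspace2, htime⟩ := isC21On_of_jets_tendstoUniformlyOn hα
    (fun i => hC (ψ (φ i))) (fun i => h1 _) (fun i => h3 _) hcu hcV hcV2 hcZ
  -- Step 4: the norm bound passes to the limit
  have hLk' : ∀ k : Fin 8, Tendsto (fun i => normParts α (u (ψ (φ i))) (ball 0 1) k) atTop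
      (𝓝 (L k)) := fun k => (hLk k).comp hφ.tendsto_atTop
  have hb0 : holderNormOn α v (ball 0 1) ≤ L 0 + L 1 :=
    holderNormOn_le_of_tendsto (fun X hX => hcu.tendsto_at hX) (hLk' 0) (hLk' 1)
  have hb1 : holderNormOn α (spaceDeriv v) (ball 0 1) ≤ L 2 + L 3 := by
    rw [holderNormOn_congr (v' := V) hspace]
    exact holderNormOn_le_of_tendsto (fun X hX => hcV.tendsto_at hX) (hLk' 2) (hLk' 3)
  have hb2 : holderNormOn α (spaceDeriv (spaceDeriv v)) (ball 0 1) ≤ L 4 + L 5 := by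
    rw [holderNormOn_congr (v' := V2) hspace2]
    exact holderNormOn_le_of_tendsto (fun X hX => hcV2.tendsto_at hX) (hLk' 4) (hLk' 5)
  have hb3 : holderNormOn α (timeDeriv v) (ball 0 1) ≤ L 6 + L 7 := by
    rw [holderNormOn_congr (v' := Z) htime]
    exact holderNormOn_le_of_tendsto (fun X hX => hcZ.tendsto_at hX) (hLk' 6) (hLk' 7)
  have hnorm : c2αNormOn α v (ball 0 1) ≤ 1 := by
    rw [c2αNormOn_eq hguard]
    calc holderNormOn α v (ball 0 1) + holderNormOn α (spaceDeriv v) (ball 0 1) +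
          holderNormOn α (spaceDeriv (spaceDeriv v)) (ball 0 1) +
          holderNormOn α (timeDeriv v) (ball 0 1)
        ≤ (L 0 + L 1) + (L 2 + L 3) + (L 4 + L 5) + (L 6 + L 7) := by gcongr
      _ = ∑ k, L k := by simp [Fin.sum_univ_succ, add_assoc]
      _ ≤ 1 := hLsum
  refine ⟨ψ ∘ φ, hψ.comp hφ, v, hnorm, hcu, ?_, ?_, ?_⟩
  · exact hcV.congr_right fun X hX => (hspace X hX).symm
  · exact hcV2.congr_right fun X hX => (hspace2 X hX).symm
  · exact hcZ.congr_right fun X hX => (htime X hX).symm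

end Compactness

end Parabolic

end Literature.Analysis.PDE
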